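import Mathlib
import HarnessLib
import Summits.Ventures.LatticeQCDFlow.Exactness.Phi4HMCFluctuationRelation
import Summits.Ventures.LatticeQCDFlow.Exactness.InvolutiveMetropolisEnergyBound
import Summits.Ventures.LatticeQCDFlow.Exactness.SU2MultiStepLeapfrogHMC
import Summits.Ventures.LatticeQCDFlow.Exactness.U1MultiStepLeapfrogHMC
import Literature.MathematicalPhysics.QuantumFieldTheory.Balaban1983to89.Beta.TransportVertices

/-!
# The error bar of the `⟨e^{−ΔH}⟩ = 1` test: `Var(e^{−ΔH}) = ⟨e^{ΔH}⟩ − 1 = ⟨ΔH²⟩ + third order`, for every exact proposal — and on the engine's rungs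

HONEST FRAMING: exact (Metropolis-corrected) sampling algorithms for lattice gauge theory;
figures of merit are autocorrelation/cost numbers at stated couplings and volumes; no
continuum-physics claim.

Venture `LatticeQCDFlow` (cell pub-lqcd), topic `Exactness`; FANOUT row 14 (`eng-flowhmc`, accepted on
`⟨e^{−ΔH}⟩ = 1 WITHIN 2σ over 10⁴ trajectories` and a reversibility test).  NEW WORK of the cell over
Mathlib and the tree; nothing is cited as a fact.  Printed counterparts, named only: Creutz 1988,
Gupta–Irbäck–Karsch–Petersson 1990 (`ΔH` statistics of HMC).

The row's acceptance criterion has TWO ingredients: the mean of `e^{−ΔH}` (Creutz's identity, typed in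
`GaugeFTHMCCreutz.lean`, `Phi4HMCFluctuationRelation.creutz_integral`) and the `σ` of the `2σ` — the
standard deviation of the estimator `N⁻¹ Σ e^{−ΔH_i}`.  In equilibrium the single-trajectory variance is
`Var(e^{−ΔH}) = ⟨(e^{−ΔH} − 1)²⟩` (the mean IS `1`), and the fluctuation relation of
`Phi4HMCFluctuationRelation.lean` evaluates it in closed form: **`⟨(e^{−ΔH} − 1)²⟩ = ⟨e^{ΔH}⟩ − 1`** —
finite exactly when the POSITIVE exponential moment `⟨e^{+ΔH}⟩` is; and to leading order it is the
mean-square violation, `⟨(e^{−ΔH} − 1)²⟩ = ⟨ΔH²⟩ + O(⟨|ΔH|³e^{2|ΔH|}⟩)`.  This file types both, for every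
measure-preserving involution, and instantiates the identity on both rungs of the engine.

## What is proved (def-free)

* §1 `abs_sq_exp_neg_sub_one_sub_sq_le` — `|(e^{−x} − 1)² − x²| ≤ |x|³ e^{2|x|}` for every real `x`
  (factor `(e^{−x} − 1 + x)(e^{−x} − 1 − x)`; Mathlib's `Complex.norm_exp_sub_sum_le_exp_norm_sub_sum` and
  the tree's `Beta.TransportVertices.expTail_two_le`, used BY NAME).
* §2 (measure space `(X, μ)`, `Ψ` a measurable `μ`-preserving involution, `ΔH = deltaH H Ψ`).
  `integrable_exp_neg_two_deltaH_mul` — `e^{−2ΔH} e^{−H}` is integrable when `e^{ΔH} e^{−H}` is;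
  **`integral_sq_exp_neg_deltaH_sub_one`** — `e^{−H}` and `e^{ΔH} e^{−H}` integrable ⇒
  `∫ (e^{−ΔH} − 1)² e^{−H} dμ = ∫ e^{ΔH} e^{−H} dμ − ∫ e^{−H} dμ`; `mean_sq_exp_neg_deltaH_sub_one` — divided
  by `Z = ∫ e^{−H} > 0`: `⟨(e^{−ΔH} − 1)²⟩ = ⟨e^{ΔH}⟩ − 1`;
  **`abs_integral_sq_exp_neg_deltaH_sub_one_sub_sq_le`** — given the moments,
  `|∫ (e^{−ΔH} − 1)² e^{−H} − ∫ ΔH² e^{−H}| ≤ ∫ |ΔH|³ e^{2|ΔH|} e^{−H}`;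
  `abs_integral_sq_exp_neg_deltaH_sub_one_sub_sq_le_of_abs_le` — `|ΔH| ≤ δ` everywhere ⇒
  `|∫ (e^{−ΔH} − 1)² e^{−H} − ∫ ΔH² e^{−H}| ≤ δ e^{2δ} ∫ ΔH² e^{−H}`.
* §3 `su2LeapfrogProposalN_creutz_variance` / §4 `u1LeapfrogProposalN_creutz_variance` — the identity of §2
  for the engine's `n`-step proposals (`sunLeapfrogProposalN pauliCoordι … ε g n` on product-Haar `SU(2)`
  links with Pauli momenta and `T_κ = κ Σ‖p_l‖²`; `u1LeapfrogProposalN ε g n` on `U(1)`), ANY measurable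
  action `S` and force `g`, any `ε`, any `nstep`, `H = S + T_κ` over `Haar^{⊗ι} ⊗ Lebesgue`, given
  integrability of `e^{−H}` (`EnergyViolationSecondOrder.integrable_exp_neg_su2Hamiltonian` /
  `…_u1Hamiltonian` supply it for `κ > 0`, `e^{−S}` integrable) and of `e^{ΔH} e^{−H}`.

Reading for the battery (no new numerics implied): for `N` independent equilibrium trajectories the
`2σ` of the test is `2√((⟨e^{ΔH}⟩ − 1)/N) ≈ 2√(⟨ΔH²⟩/N) ≈ 2√(2⟨ΔH⟩/N)` (the last step is
`EnergyViolationSecondOrder.lean`); with `ΔH = O(ε²)` this is `O(ε²/√N)`.  NOT CLAIMED: independence of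
successive trajectories (the measured error bar carries the integrated autocorrelation time of
`e^{−ΔH}`, rows 8–11), finiteness of `⟨e^{ΔH}⟩` for the engine's Gaussian momenta (a hypothesis of §3–§4;
automatic for bounded `ΔH`), anything at fixed floating-point precision.
-/

noncomputable section

namespace Summit.Ventures.LatticeQCDFlow.Exactness

open Real Set Function MeasureTheory Filter
open Literature.MathematicalPhysics.QuantumFieldTheory
open Literature.MathematicalPhysics.QuantumFieldTheory.Balaban1983to89.Beta.TransportVertices (expTail_two expTail_two_le)
open scoped ENNReal

set_option backward.isDefEq.respectTransparency false

/-! ## §1 `(e^{−x} − 1)² = x² + third order` -/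

/-- `|(e^{−x} − 1)² − x²| ≤ |x|³ e^{2|x|}` for every real `x`. -/
theorem abs_sq_exp_neg_sub_one_sub_sq_le (x : ℝ) :
    |(Real.exp (-x) - 1) ^ 2 - x ^ 2| ≤ |x| ^ 3 * Real.exp (2 * |x|) := by
  have hn : ‖((-x : ℝ) : ℂ)‖ = |x| := by rw [Complex.norm_real, Real.norm_eq_abs, abs_neg]
  have h0 : 0 ≤ |x| := abs_nonneg x
  have he1 : 1 ≤ Real.exp |x| := Real.one_le_exp h0
  -- first-order tail: |e^{−x} − 1 + x| ≤ e^{|x|} − 1 − |x| ≤ (|x|²/2) e^{|x|}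
  have hA : |Real.exp (-x) - 1 + x| ≤ |x| ^ 2 / 2 * Real.exp |x| := by
    have h := Complex.norm_exp_sub_sum_le_exp_norm_sub_sum ((-x : ℝ) : ℂ) 2
    have hs : ∑ m ∈ Finset.range 2, ((-x : ℝ) : ℂ) ^ m / (m.factorial : ℂ) = (((1 - x) : ℝ) : ℂ) := by
      simp only [Finset.sum_range_succ, Finset.sum_range_zero, Nat.factorial, pow_zero, pow_one,
        Nat.cast_one, zero_add]
      push_cast
      ring
    rw [hs, ← Complex.ofReal_exp, ← Complex.ofReal_sub, Complex.norm_real, Real.norm_eq_abs, hn] at h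
    have hs' : ∑ m ∈ Finset.range 2, |x| ^ m / (m.factorial : ℝ) = 1 + |x| := by
      simp only [Finset.sum_range_succ, Finset.sum_range_zero, Nat.factorial, pow_zero, pow_one,
        Nat.cast_one, zero_add]
      norm_num
    rw [hs'] at h
    have h2 := expTail_two_le h0
    rw [expTail_two] at h2
    rw [show Real.exp (-x) - 1 + x = Real.exp (-x) - (1 - x) by ring]
    linarith
  -- zeroth-order tail: |e^{−x} − 1 − x| ≤ (e^{|x|} − 1) + |x| ≤ 2|x| e^{|x|}
  have hB : |Real.exp (-x) - 1 - x| ≤ 2 * |x| * Real.exp |x| := by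
    have h := Complex.norm_exp_sub_sum_le_exp_norm_sub_sum ((-x : ℝ) : ℂ) 1
    simp only [Finset.sum_range_one, pow_zero, Nat.factorial_zero, Nat.cast_one, div_one] at h
    rw [← Complex.ofReal_one, ← Complex.ofReal_exp, ← Complex.ofReal_sub, Complex.norm_real, Real.norm_eq_abs,
      hn] at h
    -- e^{y} − 1 ≤ y e^{y}
    have h1 : Real.exp |x| - 1 ≤ |x| * Real.exp |x| := by
      have h' := mul_le_mul_of_nonneg_right (Real.add_one_le_exp (-|x|)) (Real.exp_pos |x|).le
      rw [← Real.exp_add, neg_add_cancel, Real.exp_zero] at h'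
      linarith
    have h3 : |x| ≤ |x| * Real.exp |x| := le_mul_of_one_le_right h0 he1
    calc |Real.exp (-x) - 1 - x| ≤ |Real.exp (-x) - 1| + |x| := abs_sub _ _
      _ ≤ 2 * |x| * Real.exp |x| := by linarith
  calc |(Real.exp (-x) - 1) ^ 2 - x ^ 2| = |Real.exp (-x) - 1 + x| * |Real.exp (-x) - 1 - x| := by
        rw [← abs_mul]; congr 1; ring
    _ ≤ |x| ^ 2 / 2 * Real.exp |x| * (2 * |x| * Real.exp |x|) := mul_le_mul hA hB (abs_nonneg _) (by positivity)
    _ = |x| ^ 3 * Real.exp (2 * |x|) := by rw [two_mul (|x|), Real.exp_add]; ring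

/-! ## §2 The variance identity and its second order, for every measure-preserving involution -/

section General

variable {X : Type*} [MeasurableSpace X] {μ : Measure X}

/-- `e^{−2ΔH} e^{−H}` is integrable when `e^{ΔH} e^{−H}` is (it is the latter composed with `Ψ`). -/
theorem integrable_exp_neg_two_deltaH_mul {H : X → ℝ} {Ψ : X → X} (hΨi : Function.Involutive Ψ)
    (hΨμ : MeasurePreserving Ψ μ μ)
    (hP : Integrable (fun z => Real.exp (deltaH H Ψ z) * Real.exp (-H z)) μ) :
    Integrable (fun z => Real.exp (-2 * deltaH H Ψ z) * Real.exp (-H z)) μ := by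
  have h : Integrable (fun z => Real.exp (deltaH H Ψ (Ψ z)) * Real.exp (-H (Ψ z))) μ :=
    (hΨμ.integrable_comp hP.aestronglyMeasurable).mpr hP
  refine h.congr (Eventually.of_forall fun z => ?_)
  simp only
  rw [deltaH_apply_involutive hΨi, ← Real.exp_add, ← Real.exp_add, deltaH]
  congr 1
  ring

/-- **THE VARIANCE OF THE CREUTZ ESTIMATOR, in closed form.**  For a measurable `μ`-preserving involution
`Ψ` and `H` with `e^{−H}` and `e^{ΔH} e^{−H}` integrable:
`∫ (e^{−ΔH} − 1)² e^{−H} dμ = ∫ e^{ΔH} e^{−H} dμ − ∫ e^{−H} dμ`. -/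
theorem integral_sq_exp_neg_deltaH_sub_one {H : X → ℝ} {Ψ : X → X} (hΨm : Measurable Ψ)
    (hΨi : Function.Involutive Ψ) (hΨμ : MeasurePreserving Ψ μ μ)
    (h0 : Integrable (fun z => Real.exp (-H z)) μ)
    (hP : Integrable (fun z => Real.exp (deltaH H Ψ z) * Real.exp (-H z)) μ) :
    ∫ z, (Real.exp (-deltaH H Ψ z) - 1) ^ 2 * Real.exp (-H z) ∂μ
      = ∫ z, Real.exp (deltaH H Ψ z) * Real.exp (-H z) ∂μ - ∫ z, Real.exp (-H z) ∂μ := by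
  have hE : Integrable (fun z => Real.exp (-deltaH H Ψ z) * Real.exp (-H z)) μ :=
    integrable_exp_neg_deltaH_mul hΨμ h0
  have h2 : Integrable (fun z => Real.exp (-2 * deltaH H Ψ z) * Real.exp (-H z)) μ :=
    integrable_exp_neg_two_deltaH_mul hΨi hΨμ hP
  have hC : ∫ z, Real.exp (-deltaH H Ψ z) * Real.exp (-H z) ∂μ = ∫ z, Real.exp (-H z) ∂μ :=
    creutz_integral hΨm hΨi hΨμ
  -- `∫ e^{−2ΔH} e^{−H} = ∫ e^{ΔH} e^{−H}` (the fluctuation relation with `g(t) = e^{−2t}`)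
  have hF : ∫ z, Real.exp (-2 * deltaH H Ψ z) * Real.exp (-H z) ∂μ
      = ∫ z, Real.exp (deltaH H Ψ z) * Real.exp (-H z) ∂μ := by
    have h := integral_comp_deltaH_eq (H := H) hΨm hΨi hΨμ (fun t => Real.exp (-2 * t))
    rw [h]
    refine integral_congr_ae (Eventually.of_forall fun z => ?_)
    simp only
    rw [← Real.exp_add]
    congr 2
    ring
  have hsplit : ∀ z, (Real.exp (-deltaH H Ψ z) - 1) ^ 2 * Real.exp (-H z)
      = (Real.exp (-2 * deltaH H Ψ z) * Real.exp (-H z) - 2 * (Real.exp (-deltaH H Ψ z) * Real.exp (-H z)))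
        + Real.exp (-H z) := by
    intro z
    have : Real.exp (-2 * deltaH H Ψ z) = Real.exp (-deltaH H Ψ z) ^ 2 := by
      rw [sq, ← Real.exp_add]; congr 1; ring
    rw [this]; ring
  simp_rw [hsplit]
  have hA : Integrable (fun z => Real.exp (-2 * deltaH H Ψ z) * Real.exp (-H z)
      - 2 * (Real.exp (-deltaH H Ψ z) * Real.exp (-H z))) μ := h2.sub (hE.const_mul 2)
  rw [integral_add hA h0, integral_sub h2 (hE.const_mul 2), integral_const_mul, hF, hC]
  ring

/-- **Normalised form**: with `Z = ∫ e^{−H} > 0` and `⟨f⟩ = Z⁻¹ ∫ f e^{−H}` (so `⟨e^{−ΔH}⟩ = 1` and the left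
side IS the equilibrium variance of `e^{−ΔH}`): `⟨(e^{−ΔH} − 1)²⟩ = ⟨e^{ΔH}⟩ − 1`. -/
theorem mean_sq_exp_neg_deltaH_sub_one {H : X → ℝ} {Ψ : X → X} (hΨm : Measurable Ψ)
    (hΨi : Function.Involutive Ψ) (hΨμ : MeasurePreserving Ψ μ μ)
    (h0 : Integrable (fun z => Real.exp (-H z)) μ)
    (hP : Integrable (fun z => Real.exp (deltaH H Ψ z) * Real.exp (-H z)) μ)
    (hZ : 0 < ∫ z, Real.exp (-H z) ∂μ) :
    (∫ z, (Real.exp (-deltaH H Ψ z) - 1) ^ 2 * Real.exp (-H z) ∂μ) / (∫ z, Real.exp (-H z) ∂μ)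
      = (∫ z, Real.exp (deltaH H Ψ z) * Real.exp (-H z) ∂μ) / (∫ z, Real.exp (-H z) ∂μ) - 1 := by
  rw [integral_sq_exp_neg_deltaH_sub_one hΨm hΨi hΨμ h0 hP, sub_div, div_self hZ.ne']

/-- **Second order**: given the moments `(e^{−ΔH} − 1)² e^{−H}`, `ΔH² e^{−H}`, `|ΔH|³ e^{2|ΔH|} e^{−H}`,
`|∫ (e^{−ΔH} − 1)² e^{−H} − ∫ ΔH² e^{−H}| ≤ ∫ |ΔH|³ e^{2|ΔH|} e^{−H}` — the variance of the Creutz estimator is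
the mean-square violation up to third order.  (No involution is needed for this step.) -/
theorem abs_integral_sq_exp_neg_deltaH_sub_one_sub_sq_le {H : X → ℝ} {Ψ : X → X}
    (hV : Integrable (fun z => (Real.exp (-deltaH H Ψ z) - 1) ^ 2 * Real.exp (-H z)) μ)
    (h2 : Integrable (fun z => deltaH H Ψ z ^ 2 * Real.exp (-H z)) μ)
    (h3 : Integrable (fun z => |deltaH H Ψ z| ^ 3 * Real.exp (2 * |deltaH H Ψ z|) * Real.exp (-H z)) μ) :
    |∫ z, (Real.exp (-deltaH H Ψ z) - 1) ^ 2 * Real.exp (-H z) ∂μ - ∫ z, deltaH H Ψ z ^ 2 * Real.exp (-H z) ∂μ|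
      ≤ ∫ z, |deltaH H Ψ z| ^ 3 * Real.exp (2 * |deltaH H Ψ z|) * Real.exp (-H z) ∂μ := by
  rw [← integral_sub hV h2]
  refine (abs_integral_le_integral_abs).trans (integral_mono_of_nonneg (Eventually.of_forall fun z => abs_nonneg _)
    h3 (Eventually.of_forall fun z => ?_))
  simp only
  rw [← sub_mul, abs_mul, abs_of_pos (Real.exp_pos (-H z))]
  exact mul_le_mul_of_nonneg_right (abs_sq_exp_neg_sub_one_sub_sq_le _) (Real.exp_pos _).le

/-- **Bounded violation**: if `|ΔH| ≤ δ` everywhere and `e^{−H}` is integrable then all moments exist and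
`|∫ (e^{−ΔH} − 1)² e^{−H} − ∫ ΔH² e^{−H}| ≤ δ e^{2δ} ∫ ΔH² e^{−H}`. -/
theorem abs_integral_sq_exp_neg_deltaH_sub_one_sub_sq_le_of_abs_le {H : X → ℝ} {Ψ : X → X}
    (hH : Measurable H) (hΨm : Measurable Ψ) (h0 : Integrable (fun z => Real.exp (-H z)) μ) {δ : ℝ}
    (hδ : ∀ z, |deltaH H Ψ z| ≤ δ) :
    |∫ z, (Real.exp (-deltaH H Ψ z) - 1) ^ 2 * Real.exp (-H z) ∂μ - ∫ z, deltaH H Ψ z ^ 2 * Real.exp (-H z) ∂μ|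
      ≤ δ * Real.exp (2 * δ) * ∫ z, deltaH H Ψ z ^ 2 * Real.exp (-H z) ∂μ := by
  have hDm : Measurable (deltaH H Ψ) := measurable_deltaH hH hΨm
  have hint : ∀ {f : ℝ → ℝ}, Continuous f → Integrable (fun z => f (deltaH H Ψ z) * Real.exp (-H z)) μ := by
    intro f hf
    obtain ⟨C, hC⟩ := (isCompact_Icc (a := -δ) (b := δ)).exists_bound_of_continuousOn hf.continuousOn
    refine h0.bdd_mul (hf.measurable.comp hDm).aestronglyMeasurable (c := C) (Eventually.of_forall fun z => ?_)
    exact hC _ (Set.mem_Icc.2 (abs_le.1 (hδ z)))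
  have hV : Integrable (fun z => (Real.exp (-deltaH H Ψ z) - 1) ^ 2 * Real.exp (-H z)) μ :=
    hint (((Real.continuous_exp.comp continuous_neg).sub continuous_const).pow 2)
  have h2 : Integrable (fun z => deltaH H Ψ z ^ 2 * Real.exp (-H z)) μ := hint (continuous_pow 2)
  have h3 : Integrable (fun z => |deltaH H Ψ z| ^ 3 * Real.exp (2 * |deltaH H Ψ z|) * Real.exp (-H z)) μ :=
    hint ((continuous_abs.pow 3).mul (Real.continuous_exp.comp (continuous_abs.const_smul (2 : ℝ))))
  refine (abs_integral_sq_exp_neg_deltaH_sub_one_sub_sq_le hV h2 h3).trans ?_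
  rw [← integral_const_mul]
  refine integral_mono h3 (h2.const_mul _) fun z => ?_
  simp only
  have ha := hδ z
  have hD0 := abs_nonneg (deltaH H Ψ z)
  have hδ0 : 0 ≤ δ := hD0.trans ha
  rw [← sq_abs (deltaH H Ψ z)]
  have he : Real.exp (2 * |deltaH H Ψ z|) ≤ Real.exp (2 * δ) := Real.exp_le_exp.2 (by linarith)
  have hw := Real.exp_pos (-H z)
  calc |deltaH H Ψ z| ^ 3 * Real.exp (2 * |deltaH H Ψ z|) * Real.exp (-H z)
      = |deltaH H Ψ z| * Real.exp (2 * |deltaH H Ψ z|) * (|deltaH H Ψ z| ^ 2 * Real.exp (-H z)) := by ring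
    _ ≤ δ * Real.exp (2 * δ) * (|deltaH H Ψ z| ^ 2 * Real.exp (-H z)) := by gcongr

end General

/-! ## §3 The `SU(2)` rung -/

section SU2

variable {ι : Type*} [Fintype ι]

/-- **THE VARIANCE OF THE CREUTZ ESTIMATOR ON THE `SU(2)` RUNG.**  Product-Haar links, Pauli momenta with
`T_κ = κ Σ‖p_l‖²`, ANY measurable action `S` and force `g`, any `ε`, any `nstep = n`, the engine's proposal
`Ψ = sunLeapfrogProposalN pauliCoordι … ε g n`, `H = S + T_κ`, `ΔH = H∘Ψ − H`: if `e^{−H}` and `e^{ΔH}e^{−H}`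
are integrable over `Haar^{⊗ι} ⊗ Lebesgue` then
`∫ (e^{−ΔH} − 1)² e^{−H} = ∫ e^{ΔH} e^{−H} − ∫ e^{−H}`. -/
theorem su2LeapfrogProposalN_creutz_variance {S : (ι → Matrix.specialUnitaryGroup (Fin 2) ℂ) → ℝ} (κ ε : ℝ)
    {g : (ι → Matrix.specialUnitaryGroup (Fin 2) ℂ) → ι → EuclideanSpace ℝ (Fin 3)} (hg : Measurable g) (n : ℕ)
    (h0 : Integrable (fun z : (ι → Matrix.specialUnitaryGroup (Fin 2) ℂ) × (ι → EuclideanSpace ℝ (Fin 3)) =>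
        Real.exp (-(S z.1 + su2Kinetic κ z.2)))
      ((Measure.pi fun _ : ι => haarProbability (Matrix.specialUnitaryGroup (Fin 2) ℂ)).prod
        (Measure.pi fun _ : ι => (volume : Measure (EuclideanSpace ℝ (Fin 3))))))
    (hP : Integrable (fun z => Real.exp (deltaH (fun z => S z.1 + su2Kinetic κ z.2)
        (⇑(sunLeapfrogProposalN pauliCoordι pauliCoordι_skew ε g n)) z) * Real.exp (-(S z.1 + su2Kinetic κ z.2)))
      ((Measure.pi fun _ : ι => haarProbability (Matrix.specialUnitaryGroup (Fin 2) ℂ)).prod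
        (Measure.pi fun _ : ι => (volume : Measure (EuclideanSpace ℝ (Fin 3)))))) :
    ∫ z, (Real.exp (-deltaH (fun z => S z.1 + su2Kinetic κ z.2)
          (⇑(sunLeapfrogProposalN pauliCoordι pauliCoordι_skew ε g n)) z) - 1) ^ 2 * Real.exp (-(S z.1 + su2Kinetic κ z.2))
        ∂((Measure.pi fun _ : ι => haarProbability (Matrix.specialUnitaryGroup (Fin 2) ℂ)).prod
          (Measure.pi fun _ : ι => (volume : Measure (EuclideanSpace ℝ (Fin 3)))))
      = ∫ z, Real.exp (deltaH (fun z => S z.1 + su2Kinetic κ z.2)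
            (⇑(sunLeapfrogProposalN pauliCoordι pauliCoordι_skew ε g n)) z) * Real.exp (-(S z.1 + su2Kinetic κ z.2))
          ∂((Measure.pi fun _ : ι => haarProbability (Matrix.specialUnitaryGroup (Fin 2) ℂ)).prod
            (Measure.pi fun _ : ι => (volume : Measure (EuclideanSpace ℝ (Fin 3)))))
        - ∫ z, Real.exp (-(S z.1 + su2Kinetic κ z.2))
          ∂((Measure.pi fun _ : ι => haarProbability (Matrix.specialUnitaryGroup (Fin 2) ℂ)).prod
            (Measure.pi fun _ : ι => (volume : Measure (EuclideanSpace ℝ (Fin 3))))) :=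
  integral_sq_exp_neg_deltaH_sub_one
    (μ := (Measure.pi fun _ : ι => haarProbability (Matrix.specialUnitaryGroup (Fin 2) ℂ)).prod
      (Measure.pi fun _ : ι => (volume : Measure (EuclideanSpace ℝ (Fin 3)))))
    (H := fun z : (ι → Matrix.specialUnitaryGroup (Fin 2) ℂ) × (ι → EuclideanSpace ℝ (Fin 3)) => S z.1 + su2Kinetic κ z.2)
    (Ψ := ⇑(sunLeapfrogProposalN pauliCoordι pauliCoordι_skew ε g n))
    (measurable_sunLeapfrogProposalN pauliCoordι pauliCoordι_skew ε n hg)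
    (involutive_sunLeapfrogProposalN (L := ι) pauliCoordι pauliCoordι_skew ε g n)
    (measurePreserving_sunLeapfrogProposalN pauliCoordι pauliCoordι_skew ε n
      (volume : Measure (EuclideanSpace ℝ (Fin 3))) hg) h0 hP

end SU2

/-! ## §4 The `U(1)` rung -/

section U1

variable {ι : Type*} [Fintype ι]

/-- **THE VARIANCE OF THE CREUTZ ESTIMATOR ON THE `U(1)` RUNG** (`Ψ = u1LeapfrogProposalN ε g n`, product-Haar
angles, real momenta, `T_κ = κ Σ p_l²`, ANY measurable `S` and `g`, any `ε`, `n`): if `e^{−H}` and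
`e^{ΔH}e^{−H}` are integrable over `Haar^{⊗ι} ⊗ Lebesgue` then
`∫ (e^{−ΔH} − 1)² e^{−H} = ∫ e^{ΔH} e^{−H} − ∫ e^{−H}`. -/
theorem u1LeapfrogProposalN_creutz_variance {S : (ι → Circle) → ℝ} (κ ε : ℝ) {g : (ι → Circle) → ι → ℝ}
    (hg : Measurable g) (n : ℕ)
    (h0 : Integrable (fun z : (ι → Circle) × (ι → ℝ) => Real.exp (-(S z.1 + u1Kinetic κ z.2)))
      ((Measure.pi fun _ : ι => haarProbability Circle).prod (volume : Measure (ι → ℝ))))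
    (hP : Integrable (fun z => Real.exp (deltaH (fun z => S z.1 + u1Kinetic κ z.2) (⇑(u1LeapfrogProposalN ε g n)) z) *
        Real.exp (-(S z.1 + u1Kinetic κ z.2)))
      ((Measure.pi fun _ : ι => haarProbability Circle).prod (volume : Measure (ι → ℝ)))) :
    ∫ z, (Real.exp (-deltaH (fun z => S z.1 + u1Kinetic κ z.2) (⇑(u1LeapfrogProposalN ε g n)) z) - 1) ^ 2 *
          Real.exp (-(S z.1 + u1Kinetic κ z.2))
        ∂((Measure.pi fun _ : ι => haarProbability Circle).prod (volume : Measure (ι → ℝ)))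
      = ∫ z, Real.exp (deltaH (fun z => S z.1 + u1Kinetic κ z.2) (⇑(u1LeapfrogProposalN ε g n)) z) *
            Real.exp (-(S z.1 + u1Kinetic κ z.2))
          ∂((Measure.pi fun _ : ι => haarProbability Circle).prod (volume : Measure (ι → ℝ)))
        - ∫ z, Real.exp (-(S z.1 + u1Kinetic κ z.2))
          ∂((Measure.pi fun _ : ι => haarProbability Circle).prod (volume : Measure (ι → ℝ))) :=
  integral_sq_exp_neg_deltaH_sub_one
    (μ := (Measure.pi fun _ : ι => haarProbability Circle).prod (volume : Measure (ι → ℝ)))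
    (H := fun z : (ι → Circle) × (ι → ℝ) => S z.1 + u1Kinetic κ z.2) (Ψ := ⇑(u1LeapfrogProposalN ε g n))
    (measurable_u1LeapfrogProposalN ε n hg) (involutive_u1LeapfrogProposalN (g := g) ε n)
    (measurePreserving_u1LeapfrogProposalN ε n hg) h0 hP

end U1

end Summit.Ventures.LatticeQCDFlow.Exactness
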